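import Summits.NavierStokesRegularity.NavierStokesRegularity.Theorems.StrainDoorsRecordIdentityCore
import HarnessLib

/-!
# Strain doors, PART J — the record identity (ROUND 59 of the ns-regularity-ideate cell)

(Tree file 2 of 2 of PART J — §J5–§J6 (sandwich, uniform derivative bounds, pinch); §J1–§J4 (magnitude identity, two-sided Fermat, record identities: classical / tangent / DSS) are in `StrainDoorsRecordIdentityCore`.
Text of nsreg-p1 g35 r59/StrainDoorsRecordIdentity.lean sha256 acddde1084c15eaa, split at the 400-line cap at a § boundary,
bodies verbatim; the one use of PART I's dropped copy `norm_laplacian_le_three` cites the tree's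
`norm_laplacian_le_three_mul` (KNSSThm52Integrand).)

At an ATTAINED record of the vorticity number `(T − t)|ω|` the time maximum is TWO-SIDED, so the Fermat step of the
record law (R53) is an EQUALITY, and the magnitude computation at the spatial maximum (`ArgmaxDoorsGrowth` E1) is an
IDENTITY with one signed term `νΔ|ω| ≤ 0`.  Hence, at an attained record `(t̄, x̄)` of a classical solution
(`vorticity_record_identity`), of every DSS singularity (`dss_vorticity_record_identity`, on R53's attainment) and
on the TANGENT FIELD of every classical Type-I solution with `ω ≢ 0` (`typeI_tangent_record_identity`, on PART H/I):
`(T − t̄)(α − ν|∇ξ|²_F) − 1 = (T − t̄)·ν·(−Δ|ω|)(x̄)/|ω(x̄)| ≥ 0` and `(T − t̄)·α − 1 = (T − t̄)·ν·(−⟪ξ, Δω⟫)(x̄)/|ω(x̄)|`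
(`typeI_tangent_record_sandwich`): the excess of the record law is EXACTLY the scaled viscous curvature of the
vorticity magnitude at its peak, and the stretching rate is sandwiched
`1 + (T − t̄)ν|∇ξ|²_F ≤ (T − t̄)α ≤ 1 + (T − t̄)ν|Δω(x̄)|/|ω(x̄)|`.  With the uniform third-derivative bound of
Type-I tangent fields (`tangent_deriv_bound`, KNSS (4.11)) this PINCHES the stretching rate at the record to the
clock rate and bounds the twist: `(0 − (−1))ᾱ − 1 ≤ K₃(C₀)/W*`, `|∇ξ̄|²_F ≤ K₃(C₀)/W*` (`typeI_tangent_record_pinch`).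

References: Koch–Nadirashvili–Seregin–Šverák, Acta Math. 203 (2009), §4 [KNSS2009]; Galanti–Gibbon–Heritage,
Nonlinearity 10 (1997) (Dw4) [GalantiGibbonHeritage1997]; Constantin–Fefferman, Indiana Univ. Math. J. 42 (1993).
-/

noncomputable section

open MeasureTheory Set Function Filter Metric Real InnerProductSpace
open _root_.Topology
open scoped ENNReal NNReal RealInnerProductSpace ContDiff Laplacian
open Literature.Analysis Literature.Analysis.FluidPDE
open Literature.Analysis.FluidPDE.VorticityDirectionDynamics

set_option linter.unusedVariables false
set_option linter.unusedSectionVars false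

namespace Summit.NavierStokesRegularity.NavierStokesRegularity.Theorems.StrainDoors

open Summit.NavierStokesRegularity.NavierStokesRegularity.Theorems.ArgmaxDoors

/-! ## §J5 The stretching rate at the record: an identity without the twist, and a sandwich -/

/-- ★★★ **THE STRETCHING RATE AT THE ATTAINED RECORD — IDENTITY AND SANDWICH.**  On the tangent field `v` of a
classical Type-I solution with `ω ≢ 0`, at the attained record `(−1, z̄)` (`ρ̄ = |ω_v(−1,z̄)| = W*`, `ξ̄`, `ᾱ`):
(i) `(0 − (−1))·ᾱ = 1 + (0 − (−1))·(−⟪ξ̄, Δω_v(−1,z̄)⟫)/ρ̄` — the stretching rate IS the clock rate plus the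
relative anti-diffusion of the vorticity along its direction (the twist has cancelled: `Δ|ω| = ⟪ξ,Δω⟫ + |ω||∇ξ|²_F`);
(ii) `ρ̄|∇ξ̄|²_F ≤ −⟪ξ̄, Δω_v(−1,z̄)⟫ ≤ |Δω_v(−1,z̄)|`;
(iii) THE SANDWICH `1 + (0 − (−1))|∇ξ̄|²_F ≤ (0 − (−1))·ᾱ ≤ 1 + (0 − (−1))·|Δω_v(−1,z̄)|/ρ̄` and the TWIST BOUND
`|∇ξ̄|²_F ≤ |Δω_v(−1,z̄)|/ρ̄`: at the peak of a tangent field with LARGE vorticity number `W* = ρ̄` (relative to the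
vorticity diffusion there) the stretching rate is pinned to the clock rate and the vorticity lines are nearly
parallel — geometric depletion, quantified at the record, with no assumption. [new-as-typed] -/
theorem typeI_tangent_record_sandwich {C₀ : ℝ}
    {u : ℝ → (EuclideanSpace ℝ (Fin 3)) → (EuclideanSpace ℝ (Fin 3))} {p : ℝ → (EuclideanSpace ℝ (Fin 3)) → ℝ}
    (hsol : IsClassicalNSSolutionOn (Iio 0) 1 0 u p) (hI : HasTypeIDecay C₀ u)
    (hcurl : ∃ t₀ : ℝ, t₀ < 0 ∧ ∃ x₀ : EuclideanSpace ℝ (Fin 3), curl (u t₀) x₀ ≠ 0) :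
    ∃ (v : ℝ → (EuclideanSpace ℝ (Fin 3)) → (EuclideanSpace ℝ (Fin 3))) (zbar : EuclideanSpace ℝ (Fin 3)),
      Continuous (uncurry v) ∧
      (∃ lam : ℕ → ℝ, (∀ j, 0 < lam j) ∧ ∀ t ≤ -(1/4 : ℝ), ∀ x,
          Tendsto (fun j => nsRescale (lam j) u t x) atTop (𝓝 (v t x)) ∧
          Tendsto (fun j => fderiv ℝ (nsRescale (lam j) u t) x) atTop (𝓝 (fderiv ℝ (v t) x)) ∧
          Tendsto (fun j => curl (nsRescale (lam j) u t) x) atTop (𝓝 (curl (v t) x))) ∧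
      (∀ t ≤ -(1/4 : ℝ), ∀ x, ‖v t x‖ ≤ C₀ / (‖x‖ + √(-t))) ∧
      IsBoundedWeakNSSolutionOn (Iio 0) isOpen_Iio 1 (fun t => v (t - 1/4)) ∧
      (∀ t ≤ -(1/2 : ℝ), ContDiff ℝ ∞ (v t)) ∧
      curl (v (-1)) zbar ≠ 0 ∧
      (∀ s : ℝ, s < 0 → ∀ y, (0 - s) * ‖curl (u s) y‖ ≤ (0 - (-1)) * ‖curl (v (-1)) zbar‖) ∧
      (∀ s ≤ -(1/4 : ℝ), ∀ y, (0 - s) * ‖curl (v s) y‖ ≤ (0 - (-1)) * ‖curl (v (-1)) zbar‖) ∧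
      (0 - (-1)) * ⟪vorticityDirection (curl (v (-1))) zbar,
            fderiv ℝ (v (-1)) zbar (vorticityDirection (curl (v (-1))) zbar)⟫ =
        1 + (0 - (-1)) * (-⟪vorticityDirection (curl (v (-1))) zbar, (Δ (curl (v (-1)))) zbar⟫) /
          ‖curl (v (-1)) zbar‖ ∧
      ‖curl (v (-1)) zbar‖ * frobeniusNormSq (fderiv ℝ (vorticityDirection (curl (v (-1)))) zbar) ≤
        -⟪vorticityDirection (curl (v (-1))) zbar, (Δ (curl (v (-1)))) zbar⟫ ∧
      -⟪vorticityDirection (curl (v (-1))) zbar, (Δ (curl (v (-1)))) zbar⟫ ≤ ‖(Δ (curl (v (-1)))) zbar‖ ∧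
      1 + (0 - (-1)) * frobeniusNormSq (fderiv ℝ (vorticityDirection (curl (v (-1)))) zbar) ≤
        (0 - (-1)) * ⟪vorticityDirection (curl (v (-1))) zbar,
            fderiv ℝ (v (-1)) zbar (vorticityDirection (curl (v (-1))) zbar)⟫ ∧
      (0 - (-1)) * ⟪vorticityDirection (curl (v (-1))) zbar,
            fderiv ℝ (v (-1)) zbar (vorticityDirection (curl (v (-1))) zbar)⟫ ≤
        1 + (0 - (-1)) * ‖(Δ (curl (v (-1)))) zbar‖ / ‖curl (v (-1)) zbar‖ ∧
      frobeniusNormSq (fderiv ℝ (vorticityDirection (curl (v (-1)))) zbar) ≤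
        ‖(Δ (curl (v (-1)))) zbar‖ / ‖curl (v (-1)) zbar‖ := by
  obtain ⟨v, zbar, hvc, hlam, hTypeI, hweak, hsm, -, hne, hnum, hnumv, -, -, hlap, hid⟩ :=
    typeI_tangent_record_identity hsol hI hcurl
  have hρ : 0 < ‖curl (v (-1)) zbar‖ := norm_pos_iff.mpr hne
  have hs1 : ContDiff ℝ ∞ (v (-1)) := hsm (-1) (by norm_num)
  have hom2 : ContDiffAt ℝ 2 (curl (v (-1))) zbar :=
    (contDiff_infty.mp (contDiff_curl (n := ⊤)
      (hs1.of_le (by exact_mod_cast (le_top : (⊤ + 1 : ℕ∞) ≤ ⊤)))) 2).contDiffAt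
  have hLap := laplacian_norm_eq hom2 hne
  have hξ : ‖vorticityDirection (curl (v (-1))) zbar‖ = 1 := norm_vorticityDirection _ hne
  obtain ⟨ρ, hρdef⟩ : ∃ ρ : ℝ, ρ = ‖curl (v (-1)) zbar‖ := ⟨_, rfl⟩
  obtain ⟨F, hFdef⟩ : ∃ F : ℝ, F = frobeniusNormSq (fderiv ℝ (vorticityDirection (curl (v (-1)))) zbar) :=
    ⟨_, rfl⟩
  obtain ⟨G, hGdef⟩ : ∃ G : ℝ, G = ⟪vorticityDirection (curl (v (-1))) zbar, (Δ (curl (v (-1)))) zbar⟫ :=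
    ⟨_, rfl⟩
  obtain ⟨a, hadef⟩ : ∃ a : ℝ, a = ⟪vorticityDirection (curl (v (-1))) zbar,
      fderiv ℝ (v (-1)) zbar (vorticityDirection (curl (v (-1))) zbar)⟫ := ⟨_, rfl⟩
  obtain ⟨Lp, hLpdef⟩ : ∃ Lp : ℝ, Lp = (Δ fun y => ‖curl (v (-1)) y‖) zbar := ⟨_, rfl⟩
  obtain ⟨M, hMdef⟩ : ∃ M : ℝ, M = ‖(Δ (curl (v (-1)))) zbar‖ := ⟨_, rfl⟩
  rw [← hρdef] at hρ hLap
  rw [← hρdef, ← hFdef, ← hadef, ← hLpdef] at hid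
  rw [← hFdef, ← hGdef, ← hLpdef] at hLap
  rw [← hLpdef] at hlap
  have hF0 : 0 ≤ F := by rw [hFdef]; exact frobeniusNormSq_nonneg _
  -- (i) the identity without the twist
  have hi : (0 - (-1)) * a = 1 + (0 - (-1)) * -G / ρ := by
    have e1 : (0 - (-1)) * -Lp / ρ = (0 - (-1)) * (a - F) - 1 := by linarith [hid]
    rw [div_eq_iff hρ.ne'] at e1
    have e2 : (0 - (-1)) * -G / ρ = (0 - (-1)) * a - 1 := by
      rw [div_eq_iff hρ.ne']
      linear_combination e1 + hLap
    linarith [e2]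
  -- (ii) `ρ F ≤ −G ≤ M`
  have hii : ρ * F ≤ -G := by linarith [hLap, hlap]
  have hGM : -G ≤ M := by
    have h := abs_real_inner_le_norm (vorticityDirection (curl (v (-1))) zbar) ((Δ (curl (v (-1)))) zbar)
    rw [hξ, one_mul, ← hGdef, ← hMdef] at h
    linarith [neg_abs_le G]
  -- (iii) sandwich and twist bound
  have hlow : 1 + (0 - (-1)) * F ≤ (0 - (-1)) * a := by
    have h : F ≤ -G / ρ := by rw [le_div_iff₀ hρ]; linarith [hii]
    have e : (0 - (-1)) * -G / ρ = (0 - (-1)) * (-G / ρ) := by ring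
    linarith [hi, e]
  have hup : (0 - (-1)) * a ≤ 1 + (0 - (-1)) * M / ρ := by
    have h : (0 - (-1)) * -G / ρ ≤ (0 - (-1)) * M / ρ :=
      div_le_div_of_nonneg_right (by linarith [hGM]) hρ.le
    linarith [hi, h]
  have htw : F ≤ M / ρ := by
    rw [le_div_iff₀ hρ]; linarith [hii, hGM]
  subst hρdef hFdef hGdef hadef hMdef
  exact ⟨v, zbar, hvc, hlam, hTypeI, hweak, hsm, hne, hnum, hnumv, hi, hii, hGM, hlow, hup, htw⟩

/-! ## §J6 Uniform derivative bounds on tangent fields and the pinching of the stretching rate -/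

/-- **Uniform derivative bounds for Type-I tangent fields.**  There are constants `K_k = K_k(C₀)` such that every
continuous `v`, Type-I with constant `C₀` on `t ≤ −1/4` and with `t ↦ v(t − 1/4)` bounded-weak ancient, satisfies
`‖Dᵏv(t₁,x)‖ ≤ K_k` for all `k ≥ 1`, `t₁ ≤ −1/2`, `x` (KNSS (4.11) on the window; the drift is constant in `x`).
[folklore-typed] -/
theorem tangent_deriv_bound (C₀ : ℝ) : ∃ K : ℕ → ℝ,
    ∀ {v : ℝ → (EuclideanSpace ℝ (Fin 3)) → (EuclideanSpace ℝ (Fin 3))}, Continuous (uncurry v) →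
      (∀ t ≤ -(1/4 : ℝ), ∀ x, ‖v t x‖ ≤ C₀ / (‖x‖ + √(-t))) →
      IsBoundedWeakNSSolutionOn (Iio 0) isOpen_Iio 1 (fun t => v (t - 1/4)) →
      ∀ t₁ ≤ -(1/2 : ℝ), ∀ (x : EuclideanSpace ℝ (Fin 3)) (k : ℕ), 1 ≤ k →
        ‖iteratedFDeriv ℝ k (v t₁) x‖ ≤ K k := by
  obtain ⟨T, hT⟩ : ∃ T : ℝ, T = 17/8 := ⟨_, rfl⟩
  have hT0 : (0:ℝ) < T := by rw [hT]; norm_num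
  obtain ⟨Cw, Lw, N, hwin⟩ := KNSS2009_regularity_boundedWeak_window_holds (2 * C₀) T hT0
  refine ⟨fun k => Cw k (1/2), ?_⟩
  intro v hvc hTypeI hweak t₁ ht₁ x k hk
  have hC₀ : 0 ≤ C₀ := by
    have h := (norm_nonneg _).trans (hTypeI (-1) (by norm_num) 0)
    simpa using h
  -- the window solution `w τ = v (τ + t₁ − 2)` on `(0, 17/8)`
  obtain ⟨w, hw⟩ : ∃ w : ℝ → (EuclideanSpace ℝ (Fin 3)) → (EuclideanSpace ℝ (Fin 3)),
      w = fun τ => v (τ + t₁ - 2) := ⟨_, rfl⟩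
  have hJ : ∀ t, t ∈ Iio (7/4 - t₁) ↔ t + (t₁ - 7/4) ∈ Iio (0:ℝ) := fun t => by
    simp only [mem_Iio]; constructor <;> intro h <;> linarith
  have hweakJ := hweak.comp_add_right (t₁ - 7/4) isOpen_Iio hJ
  have hfun : (fun t => (fun t => v (t - 1/4)) (t + (t₁ - 7/4))) = w := by
    funext t; rw [hw]; dsimp only; congr 1; ring
  rw [hfun] at hweakJ
  have hsubJ : Ioo 0 T ⊆ Iio (7/4 - t₁) := fun t ht => by
    simp only [mem_Iio, mem_Ioo, hT] at ht ⊢; linarith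
  have hweakW : IsBoundedWeakNSSolutionOn (Ioo 0 T) isOpen_Ioo 1 w := hweakJ.mono isOpen_Ioo hsubJ
  -- `|w| ≤ 2C₀` on the window
  have htime : ∀ τ ∈ Ioo 0 T, τ + t₁ - 2 ≤ -(1/4 : ℝ) := fun τ hτ => by
    simp only [mem_Ioo, hT] at hτ; linarith
  have hbd : ∀ τ ∈ Ioo 0 T, ∀ y, ‖w τ y‖ ≤ 2 * C₀ := fun τ hτ y => by
    have h1 := hTypeI (τ + t₁ - 2) (htime τ hτ) y
    have hsq : (1/2 : ℝ) ≤ √(-(τ + t₁ - 2)) := by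
      have e : (1/2 : ℝ) = √(1/4) := by
        rw [show (1/4 : ℝ) = (1/2) ^ 2 by norm_num, Real.sqrt_sq (by norm_num)]
      rw [e]; exact Real.sqrt_le_sqrt (by linarith [htime τ hτ])
    have hden : (1/2 : ℝ) ≤ ‖y‖ + √(-(τ + t₁ - 2)) := by linarith [norm_nonneg y]
    calc ‖w τ y‖ = ‖v (τ + t₁ - 2) y‖ := by rw [hw]
      _ ≤ C₀ / (‖y‖ + √(-(τ + t₁ - 2))) := h1
      _ ≤ C₀ / (1/2) := div_le_div_of_nonneg_left hC₀ (by norm_num) hden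
      _ = 2 * C₀ := by ring
  -- the KNSS representative on the window
  obtain ⟨U, b, -, -, -, hae, hUs, -, hUC, hUL, -⟩ := hwin hweakW hbd
  have hSsub : Ioo (1/2 : ℝ) T ⊆ Ioo 0 T := Ioo_subset_Ioo_left (by norm_num)
  -- continuity in time
  have hwcont : ∀ y, Continuous fun τ => w τ y := fun y => by
    rw [hw]
    exact hvc.comp (((continuous_id.add continuous_const).sub continuous_const).prodMk continuous_const)
  have hwcontx : ∀ τ, Continuous (w τ) := fun τ => by
    rw [hw]; exact hvc.comp (continuous_const.prodMk continuous_id)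
  have hUline := fun y => knss_rep_continuousOn (T := T) (δ := 1/2) (by norm_num) hUs
    (fun k σ hσ τ hτ z => hUL (1/2) (by norm_num) k σ hσ τ hτ z) y
  -- the continuous drift `bt = w(·,0) − U(·,0)` and `w = U + bt` at EVERY time of `(1/2, T)`
  obtain ⟨bt, hbt⟩ : ∃ bt : ℝ → EuclideanSpace ℝ (Fin 3), bt = fun τ => w τ 0 - U τ 0 := ⟨_, rfl⟩
  have hbt_cont : ContinuousOn bt (Ioo (1/2 : ℝ) T) := by
    rw [hbt]; exact ((hwcont 0).continuousOn).sub (hUline 0).1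
  have hgood : ∀ᵐ τ ∂volume, τ ∈ Ioo 0 T → w τ = fun y => U τ y + b τ := by
    have h1 := (ae_restrict_iff' (measurableSet_Ioo : MeasurableSet (Ioo (0:ℝ) T))).1 hae
    filter_upwards [h1] with τ hτ hτm
    exact (Continuous.ae_eq_iff_eq volume (hwcontx τ)
      ((hUs τ hτm).continuous.add continuous_const)).1 (hτ hτm)
  have hrep : ∀ τ ∈ Ioo (1/2 : ℝ) T, ∀ y, w τ y = U τ y + bt τ := by
    intro τ hτ y
    have hcont : ContinuousOn (fun σ => ‖(w σ y - U σ y) - bt σ‖) (Ioo (1/2 : ℝ) T) :=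
      ((((hwcont y).continuousOn).sub (hUline y).1).sub hbt_cont).norm
    have hae' : ∀ᵐ σ ∂(volume.restrict (Ioo (1/2 : ℝ) T)), ‖(w σ y - U σ y) - bt σ‖ ≤ 0 := by
      rw [ae_restrict_iff' measurableSet_Ioo]
      filter_upwards [hgood] with σ hσ hσS
      have e := hσ (hSsub hσS)
      have e1 : w σ y = U σ y + b σ := by rw [e]
      have e0 : w σ 0 = U σ 0 + b σ := by rw [e]
      rw [hbt]; dsimp only
      rw [e1, e0]; simp
    have h0 := ChaeWolf.le_of_ae_le_of_continuousOn hcont hae' τ hτ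
    have h00 : ‖(w τ y - U τ y) - bt τ‖ = 0 := le_antisymm h0 (norm_nonneg _)
    rw [norm_eq_zero, sub_eq_zero] at h00
    rw [← h00]; abel
  have hrepF : ∀ τ ∈ Ioo (1/2 : ℝ) T, w τ = fun y => U τ y + bt τ := fun τ hτ => funext (hrep τ hτ)
  have h2S : (2 : ℝ) ∈ Ioo (1/2 : ℝ) T := by rw [hT]; constructor <;> norm_num
  have hw2 : w 2 = v t₁ := by rw [hw]; dsimp only; congr 1; ring
  rw [← hw2, hrepF 2 h2S]
  have e : (fun y => U 2 y + bt 2) = U 2 + fun _ => bt 2 := rfl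
  have hk0 : k ≠ 0 := by omega
  rw [e, iteratedFDeriv_add_apply (((hUs 2 (hSsub h2S)).of_le (by exact_mod_cast le_top)).contDiffAt)
    contDiff_const.contDiffAt, iteratedFDeriv_const_of_ne hk0, Pi.zero_apply, add_zero]
  exact hUC (1/2) (by norm_num) k 2 h2S x

/-- **Uniform bound on the vorticity diffusion of Type-I tangent fields:** `‖Δω_v(t₁,x)‖ ≤ K₃(C₀)` for
`t₁ ≤ −1/2` (`|Δf| ≤ 3‖D²f‖`, `‖D²curl h‖ ≤ 4‖D³h‖`). [folklore-typed] -/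
theorem tangent_laplacian_curl_bound (C₀ : ℝ) : ∃ K₃ : ℝ, 0 ≤ K₃ ∧
    ∀ {v : ℝ → (EuclideanSpace ℝ (Fin 3)) → (EuclideanSpace ℝ (Fin 3))}, Continuous (uncurry v) →
      (∀ t ≤ -(1/4 : ℝ), ∀ x, ‖v t x‖ ≤ C₀ / (‖x‖ + √(-t))) →
      IsBoundedWeakNSSolutionOn (Iio 0) isOpen_Iio 1 (fun t => v (t - 1/4)) →
      ∀ t₁ ≤ -(1/2 : ℝ), ∀ (x : EuclideanSpace ℝ (Fin 3)), ‖(Δ (curl (v t₁))) x‖ ≤ K₃ := by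
  obtain ⟨K, hK⟩ := tangent_deriv_bound C₀
  refine ⟨max 0 (12 * K 3), le_max_left _ _, ?_⟩
  intro v hvc hTypeI hweak t₁ ht₁ x
  have hs : ContDiff ℝ ∞ (v t₁) := (tangent_vorticity_eq hvc hTypeI hweak ht₁ x).1
  calc ‖(Δ (curl (v t₁))) x‖ ≤ 3 * ‖iteratedFDeriv ℝ 2 (curl (v t₁)) x‖ := norm_laplacian_le_three_mul _ _
    _ ≤ 3 * (4 * ‖iteratedFDeriv ℝ 3 (v t₁) x‖) := by
        gcongr; exact norm_iteratedFDeriv_curl_le_four_mul hs 2 x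
    _ ≤ 3 * (4 * K 3) := by
        gcongr; exact hK hvc hTypeI hweak t₁ ht₁ x 3 (by norm_num)
    _ ≤ max 0 (12 * K 3) := by rw [show 3 * (4 * K 3) = 12 * K 3 by ring]; exact le_max_right _ _

/-- ★★★ **PINCHING OF THE STRETCHING RATE AT THE RECORD (dimensionless, constants depending on `C₀` only).**
There is `K₃ = K₃(C₀) ≥ 0` such that for EVERY classical Type-I solution `(u,p)` with constant `C₀` and `ω ≢ 0`,
on its tangent field `v` at the attained record `(−1, z̄)` (`ρ̄ = |ω_v(−1,z̄)|` majorises `(0 − s)|ω_u(s,y)|` for all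
`s < 0`, i.e. `ρ̄ ≥ W*`, and is attained):
`1 + (0 − (−1))|∇ξ̄|²_F ≤ (0 − (−1))·ᾱ ≤ 1 + (0 − (−1))·K₃/ρ̄`  and  `|∇ξ̄|²_F ≤ K₃/ρ̄`.
A Type-I blow-up with a LARGE vorticity number has, at the peak of its tangent field, stretching rate equal to the
clock rate up to `K₃/W*` and twist at most `K₃/W*`. [new-as-typed] -/
theorem typeI_tangent_record_pinch (C₀ : ℝ) : ∃ K₃ : ℝ, 0 ≤ K₃ ∧
    ∀ {u : ℝ → (EuclideanSpace ℝ (Fin 3)) → (EuclideanSpace ℝ (Fin 3))} {p : ℝ → (EuclideanSpace ℝ (Fin 3)) → ℝ},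
      IsClassicalNSSolutionOn (Iio 0) 1 0 u p → HasTypeIDecay C₀ u →
      (∃ t₀ : ℝ, t₀ < 0 ∧ ∃ x₀ : EuclideanSpace ℝ (Fin 3), curl (u t₀) x₀ ≠ 0) →
      ∃ (v : ℝ → (EuclideanSpace ℝ (Fin 3)) → (EuclideanSpace ℝ (Fin 3))) (zbar : EuclideanSpace ℝ (Fin 3)),
        Continuous (uncurry v) ∧
        (∃ lam : ℕ → ℝ, (∀ j, 0 < lam j) ∧ ∀ t ≤ -(1/4 : ℝ), ∀ x,
            Tendsto (fun j => nsRescale (lam j) u t x) atTop (𝓝 (v t x)) ∧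
            Tendsto (fun j => fderiv ℝ (nsRescale (lam j) u t) x) atTop (𝓝 (fderiv ℝ (v t) x)) ∧
            Tendsto (fun j => curl (nsRescale (lam j) u t) x) atTop (𝓝 (curl (v t) x))) ∧
        curl (v (-1)) zbar ≠ 0 ∧
        (∀ s : ℝ, s < 0 → ∀ y, (0 - s) * ‖curl (u s) y‖ ≤ (0 - (-1)) * ‖curl (v (-1)) zbar‖) ∧
        (∀ s ≤ -(1/4 : ℝ), ∀ y, (0 - s) * ‖curl (v s) y‖ ≤ (0 - (-1)) * ‖curl (v (-1)) zbar‖) ∧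
        1 + (0 - (-1)) * frobeniusNormSq (fderiv ℝ (vorticityDirection (curl (v (-1)))) zbar) ≤
          (0 - (-1)) * ⟪vorticityDirection (curl (v (-1))) zbar,
              fderiv ℝ (v (-1)) zbar (vorticityDirection (curl (v (-1))) zbar)⟫ ∧
        (0 - (-1)) * ⟪vorticityDirection (curl (v (-1))) zbar,
              fderiv ℝ (v (-1)) zbar (vorticityDirection (curl (v (-1))) zbar)⟫ ≤
          1 + (0 - (-1)) * K₃ / ‖curl (v (-1)) zbar‖ ∧
        frobeniusNormSq (fderiv ℝ (vorticityDirection (curl (v (-1)))) zbar) ≤ K₃ / ‖curl (v (-1)) zbar‖ := by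
  obtain ⟨K₃, hK₃, hb⟩ := tangent_laplacian_curl_bound C₀
  refine ⟨K₃, hK₃, ?_⟩
  intro u p hsol hI hcurl
  obtain ⟨v, zbar, hvc, hlam, hTypeI, hweak, hsm, hne, hnum, hnumv, -, -, -, hlow, hup, htw⟩ :=
    typeI_tangent_record_sandwich hsol hI hcurl
  have hρ : 0 < ‖curl (v (-1)) zbar‖ := norm_pos_iff.mpr hne
  have hM : ‖(Δ (curl (v (-1)))) zbar‖ ≤ K₃ := hb hvc hTypeI hweak (-1) (by norm_num) zbar
  refine ⟨v, zbar, hvc, hlam, hne, hnum, hnumv, hlow, ?_, ?_⟩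
  · have h : (0 - (-1)) * ‖(Δ (curl (v (-1)))) zbar‖ / ‖curl (v (-1)) zbar‖ ≤
        (0 - (-1)) * K₃ / ‖curl (v (-1)) zbar‖ :=
      div_le_div_of_nonneg_right (by linarith [hM]) hρ.le
    linarith [hup, h]
  · exact htw.trans (div_le_div_of_nonneg_right hM hρ.le)

end Summit.NavierStokesRegularity.NavierStokesRegularity.Theorems.StrainDoors

end
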